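import Summits.NavierStokesRegularity.NavierStokesRegularity.Theses.TypeICertificateLadder
import Literature.Analysis.FluidPDE.TypeIAncientMildClassical
import Literature.Analysis.FluidPDE.AncientSimilarityVariables

/-!
# Line `head-flux-channel` for crux `Target` ≡ `TypeICertificateLadder.NoTypeIBlowup`
# (item stmt-NavierStokesRegularity-1217) — crux-plan skeleton, round 1

planner-cruxplan-stmt-NavierStokesRegularity-1217-head-flux-channel-0, 2026-08-16.
Idea card `Cruxes/Target/Ideas/head-flux-channel.md` (ideator 2); triage r1-1 pass, r1-2 pass,
r1-3 fail (sharpenings adopted: RATE class only — no `HasTypeIDecay`, no `normalisedPressure`;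
benchmark of the rung sub-case is `C ≥ 1.035`, see the line card `Lines/head-flux-channel.md`).

THE LINE. In backward similarity variables `U = lerayOrbit ū`, `P = lerayOrbitPressure q`
(`U(s,y) = e^{-s/2} ū(-e^{-s}, e^{-s/2}y)`, `P = (-t) q`), Gaussian weight `G(y) = e^{-‖y‖²/4}`,
a Type-I ancient mild field `ū` (Oseen gauge, rate `‖ū(t,x)‖ ≤ C/√(-t)`, i.e. `‖U‖ ≤ C`) has the
three Gaussian functionals
  `E(s) = ∫ ½‖U‖² G`,  `D(s) = ∫ |∇U|²_F G`,  `Ch(s) = ∫ (½‖U‖² + P) ⟪y, U⟫ G`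
(energy, dissipation, HEAD-FLUX CHANNEL through Gaussian shells; `⟪y,U⟫ = ⟪x,u⟫` is the radial
Reynolds scalar, sphere-mean free, so `Ch` does not see the pressure gauge `P ↦ P + c(s)`), and the
Ornstein–Uhlenbeck self-adjointness of `Δ − ½y·∇` in `L²(G dy)` makes the Gaussian energy identity
EXACT with ONE indefinite term (S2):
  `E'(s) = −D(s) − E(s) − ½ Ch(s)`.
Hence (S3) a Type-I ancient field whose head INFLUX `−½Ch` cannot supply more than the fraction
`1 − ε` of the budget `D + E` over long similarity-time windows has `E' ≤ −ε E` in the mean,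
`E` bounded on `ℝ` ⇒ `E ≡ 0` ⇒ `ū ≡ 0`. The physical solution enters only through the zoom (S1):
a Clay-class solution with eventual rate `√(T−t)‖u‖ ≤ C√ν` that does not extend generates a
NONTRIVIAL Type-I ancient mild field with the SAME constant `C` (KNSS 2009 §6 at near-maxima,
keeping the Type-I window; this is where finite energy / Leray–Hopf is used —
`Disproof.lean` §2 `target_false_without_lerayHopf`, `target_false_without_energy`). The
load-bearing stub is the HEAD-INFLUX LAW (S4), stated per rung constant `C`; the composition runs
through the route's proved `LadderGlue_holds` (all rungs ⇒ `NoTypeIBlowup`).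

* `stub_typeIZoom` (S1, XL, infrastructure shared with every profile-side line; TRUE by KNSS 2009
  Prop. 6.1 + Type-I bookkeeping).
* `stub_gaussianEnergyIdentity` (S2, L, provable calculus: differentiation under the integral,
  OU integration by parts, `∫⟪y,U⟫G = 0`).
* `stub_headFluxCriterion` (S3, M, provable: backward Grönwall on `ℝ` + definiteness of `E`).
* `stub_headInfluxLaw` (S4, the crux of the line: TRUE iff Type-I Liouville in the rate class;
  small-`C` sub-case by Gaussian-shell estimates = a rung of the host ladder; for `C ≥ C_Scheffer`
  any proof must use the equation beyond the local energy inequality — the law FAILS for the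
  Type-I DSS profiles of Scheffer's Navier–Stokes-INEQUALITY blow-up, in tree
  `NavierStokesInequalitySingularSolution_holds`; see the card, § Barriers).
* `Target_of : NoTypeIBlowup` — kernel-checked composition S1 → S2 → S3 ← S4 via `LadderGlue_holds`.

All stubs are stated over TREE VOCABULARY ONLY (fully inlined, no local definitions), so each can
be landed verbatim under `Summits/…/Theorems/` with `--supports stmt-NavierStokesRegularity-1217`.
Crux FQ name for the audit: `Summit.NavierStokesRegularity.NavierStokesRegularity.Theses.TypeICertificateLadder.NoTypeIBlowup`
(primary route; `ThreadingFlux.Target` / `CoreLogGas.NoTypeIBlowup` are the same term, `Iff.rfl`,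
Disproof.lean §0) — run `ledger skeleton check … --crux-decl <that name>`.
-/

noncomputable section

namespace Summit.NavierStokesRegularity.NavierStokesRegularity.Cruxes.Target.HeadFluxChannel

open MeasureTheory Set Filter Topology
open scoped RealInnerProductSpace
open Literature.Analysis.FluidPDE
open Summit.NavierStokesRegularity.NavierStokesRegularity.Theses.TypeICertificateLadder

set_option linter.dupNamespace false

/-! ## The stubs (S1a, S1b, S2a, S2b, S2c, S3, S4) — lead's reshape 2026-08-16 of the planner's S1–S4

The LEAD (prover-line-stmt-NavierStokesRegularity-1217-0) split S1 into the zoom proper (S1a) and the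
global pressure gauge (S1b), and S2 into its three clauses (S2a continuity of `D`, S2b continuity of
`Ch`, S2c the derivative identity), so that seven registered stubs of worker size compose to the crux;
the composition `Target_of` and the free corollary `toroidalLiouville_of_S2_S3` are unchanged in content. -/

/-- **S1a — Type-I ZOOM to the Oseen-gauge rate class, per rung constant** (lead's reshape
2026-08-16: the classical pressure on `(−∞,0)` is split off as S1b `stub_ancientPressure`).**
** A classical solution
of Navier–Stokes (viscosity `ν`) on `ℝ³ × [0,T)`, Leray–Hopf from its rapidly decaying datum, with
the eventual dimensionless rate `√(T−t)‖u(t,x)‖ ≤ C√ν`, which does NOT extend classically past `T`,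
generates a Type-I ancient mild field `ū` with the SAME constant `C` (`IsTypeIAncientMild C ū`:
jointly smooth on `t < 0`, divergence free, Oseen-mild between all pairs of negative times,
`‖ū(t,x)‖ ≤ C/√(−t)`), and `ū ≢ 0` (the pressure is S1b).
Why true: normalise `ν = 1` (`v(s,x) = ν⁻¹u(s/ν,x)`, rate constant `C` — Disproof.lean §6
`target_iff_unit`); `u` is the Kato/mild solution from its datum, pointwise bounded on every
`[0,T'] × ℝ³`, unbounded up to `T` (Disproof.lean §4 `counterexample_isKato`,
`pointwise_bounded_before`, `counterexample_unbounded` — the Leray–Hopf / finite-energy clause is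
used exactly here, honouring `target_false_without_lerayHopf` / `target_false_without_energy`);
KNSS 2009 §6 zoom `v_k(y,σ) = M_k⁻¹ v(x_k + y/M_k, t_k + σ/M_k²)` at near-maxima `M_k ↑ ∞`: the
Type-I window gives `‖v_k(y,σ)‖ ≤ C/√(S_k − σ)` with `S_k = (T−t_k)M_k² ∈ [c₀, C²]` (local
`L^∞` existence / rate), a subsequence `S_k → S⋆`, the compactness of bounded mild solutions
(KNSS Lemma 6.1, Prop. 4.1; in tree `KNSS2009_blowup_generates_ancient_holds` for the un-windowed
version, `exists_tendsto_of_isTypeIAncientMild_seq` for the `C¹_loc` extraction in the class)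
gives a mild limit on `(−∞, S⋆)` with `‖v̄(y,σ)‖ ≤ C/√(S⋆ − σ)` and `‖v̄(0,0)‖ = 1`; `ū(t) := v̄(t + S⋆)`
is in the class (`isTypeIAncientMild_of_continuous_oseenMild`, KNSS Prop. 4.1) and
`ū(−S⋆, 0) ≠ 0`; the pressure from Fabes–Jones–Rivière on windows
(`IsTypeIAncientMild.exists_isClassicalNSSolutionOn_Ioo`) glued along `t₀ = −n` by the gauge
`q(t,0) = 0` (pressures of one velocity differ by a function of `t`). Size XL; cf. the pending
(unlanded) prover chain `exists_typeI_ancient_profile_of_not_hasSmoothExtensionPast` on this item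
and Albritton–Barker 2019 Thm. 1.1 (forward direction). -/
theorem stub_typeIZoom :
    ∀ C : ℝ, 0 < C → ∀ (ν T : ℝ), 0 < ν → 0 < T →
      ∀ (u : ℝ → EuclideanSpace ℝ (Fin 3) → EuclideanSpace ℝ (Fin 3))
        (p : ℝ → EuclideanSpace ℝ (Fin 3) → ℝ),
        IsClassicalNSSolutionOn (Set.Ico 0 T) ν 0 u p →
        IsLerayHopfOn T ν 0 (u 0) u →
        HasRapidSpatialDecay (u 0) →
        (∀ᶠ t in 𝓝[<] T, ∀ x, Real.sqrt (T - t) * ‖u t x‖ ≤ C * Real.sqrt ν) →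
        ¬ HasSmoothExtensionPast ν 0 u T →
        ∃ (ū : ℝ → EuclideanSpace ℝ (Fin 3) → EuclideanSpace ℝ (Fin 3)),
          IsTypeIAncientMild C ū ∧ ¬ (∀ t < 0, ∀ x, ū t x = 0) := by
  sorry

/-- **S1b — a GLOBAL classical pressure for the rate class** (lead's reshape of S1, 2026-08-16:
the zoom S1a delivers the velocity; the pressure is supplied separately, for EVERY member of the
class). Every Type-I ancient mild field `ū` (Oseen gauge) admits a scalar `q` with `(ū, q)` a
classical Navier–Stokes solution (viscosity `1`, no force) on the whole past `(−∞, 0)`.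
Why true: on every window `(a, b)`, `a < b < 0`, the tree theorem
`IsTypeIAncientMild.exists_isClassicalNSSolutionOn_Ioo` (Fabes–Jones–Rivière / KNSS §4: bounded
mild solutions are classical with the pressure `RᵢRⱼ(uᵢuⱼ)` up to normalisation) gives a classical
pressure `q_{(a,b)}`; two classical pressures of the same smooth velocity on a common window have
equal spatial gradients (the momentum equation determines `∇q`), hence differ by a function of time
only; normalising `q_{(a,b)}(t, 0) = 0` makes them AGREE on overlaps, so the normalised pressures of
the exhausting windows `(−n−2, −1/(n+2))` patch to one `q` on `(−∞,0) × ℝ³`, smooth (locally it is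
one of the `q_n`) and satisfying the momentum equation pointwise (the gradient is unchanged by the
normalisation). Size M (bookkeeping: `ContDiffOn` is local; `IsClassicalNSSolutionOn` on a union of
open windows). [Leans on: `IsTypeIAncientMild.exists_isClassicalNSSolutionOn_Ioo`,
`IsTypeIAncientMild.contDiffOn`, `IsClassicalNSSolutionOn` API (`momentum`, `divFree`,
`smooth_velocity`, `smooth_pressure`), `timeDerivWithin_eq_deriv` for open time sets.] -/
theorem stub_ancientPressure :
    ∀ (C : ℝ) (u : ℝ → EuclideanSpace ℝ (Fin 3) → EuclideanSpace ℝ (Fin 3)),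
      IsTypeIAncientMild C u →
      ∃ q : ℝ → EuclideanSpace ℝ (Fin 3) → ℝ, IsClassicalNSSolutionOn (Set.Iio 0) 1 0 u q := by
  sorry

/-- **S2a — continuity of the GAUSSIAN DISSIPATION `D(s) = ∫ |∇U|²_F G`** (lead's reshape of S2,
2026-08-16: S2 = S2a ∧ S2b ∧ S2c; this docstring keeps the planner's description of the whole of S2).
**S2 — the GAUSSIAN ENERGY IDENTITY of the Leray profile flow (the lever (GE)).** For a
Type-I ancient mild field `u` with a classical pressure `p` on `(−∞,0)`, in backward similarity
variables `U = lerayOrbit u`, `P = lerayOrbitPressure p` (so `(U,P)` solves the backward Leray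
system `∂ₛU + ½U + ½(y·∇)U + (U·∇)U + ∇P = ΔU`, tree
`isClassicalNSSolutionOn_iff_isBackwardLeraySolutionOn_lerayOrbit`) and with `G = e^{−‖y‖²/4}`:
the dissipation `D(s) = ∫ |∇U|²_F G` and the channel `Ch(s) = ∫ (½‖U‖² + P)⟪y,U⟫ G` are continuous
in `s`, and the Gaussian energy `E(s) = ∫ ½‖U‖² G` is differentiable with
`E' = −D − E − ½Ch` at every `s`.
Why true (re-derived by all three triagers and CAS job j007038): `E' = ∫⟨U, ∂ₛU⟩G`;
`∫⟨U, ΔU − ½(y·∇)U⟩G = −D` exactly (`∇G = −½yG`, Ornstein–Uhlenbeck self-adjointness);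
`∫⟨U, −½U⟩G = −E`; `∫⟨U, (U·∇)U + ∇P⟩G = ∫ U·∇(½‖U‖² + P) G = −∫(½‖U‖²+P) U·∇G = ½Ch`
(`div U = 0`); the gauge `P ↦ P + c(s)` drops out since `∫⟪y,U⟫G = −2∫ div U · G = 0`.
Integrability / differentiation under the integral: `‖U‖ ≤ C`, class-uniform bounds on
`∇U, ∇²U, ∂ₛU` from KNSS Prop. 4.1 (tree: `SqueezeCycleExtremalElementExistsRegularity`), hence
`∇P` bounded and `P` of linear growth on each slice, all against the Gaussian. Size L.
[Leans on: `lerayOrbit_apply`, `contDiff_uncurry_lerayOrbit`, `lerayOrbitPressure`,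
`IsBackwardLeraySolutionOn.momentum_leray`, `frobeniusNormSq_eq_sum`, Mathlib
`hasDerivAt_integral_of_dominated_loc_of_deriv_le`, `integral_mul_deriv`-type IBP on `ℝ³`
(`integral_divergence`-style lemmas / `LineDeriv.IntegrationByParts`).] -/
theorem stub_gaussianDissipationContinuous :
    ∀ (C : ℝ) (u : ℝ → EuclideanSpace ℝ (Fin 3) → EuclideanSpace ℝ (Fin 3)),
      IsTypeIAncientMild C u →
      Continuous (fun s : ℝ =>
          ∫ y, frobeniusNormSq (fderiv ℝ (lerayOrbit u s) y) * Real.exp (-‖y‖ ^ 2 / 4)) := by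
  sorry

/-- **S2b — continuity of the HEAD-FLUX CHANNEL `Ch(s) = ∫ (½‖U‖² + P)⟪y,U⟫ G`** (lead's reshape of
S2, 2026-08-16). For a Type-I ancient mild field `u` with a classical pressure `p` on `(−∞,0)`,
`U = lerayOrbit u`, `P = lerayOrbitPressure p` (`P(s,y) = e^{−s} p(−e^{−s}, e^{−s/2}y)`), the channel
is a continuous function of `s`. Why true: the integrand is jointly continuous in `(s, y)` (joint
smoothness of `u`, `p` on the slab, `contDiff_uncurry_lerayOrbit`-type lemmas) and dominated on
compact `s`-ranges by `(A + B‖y‖) · C‖y‖ · G(y)`, integrable: `‖U‖ ≤ C`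
(`IsTypeIAncientMild.norm_le`), and `P(s, ·)` has LINEAR GROWTH locally uniformly in `s` because
`∇p = Δu − ∂ₜu − (u·∇)u` (momentum equation) is bounded on every window `[a+δ, b) × ℝ³` by the
class-uniform bounds `exists_norm_iteratedFDeriv_le_of_typeI` (k = 0, 1, 2) and
`exists_lipschitz_time_of_typeI` (k = 0, giving `‖∂ₜu‖ ≤ L`), whence `|p(t,x)| ≤ |p(t,0)| + K‖x‖`
(mean value along the segment) with `t ↦ p(t,0)` continuous. Conclude with Mathlib's
`continuousAt_of_dominated` / `continuous_of_dominated`. Size L−.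
[Leans on: `lerayOrbit_apply`, `lerayOrbitPressure` (`uncurry_lerayOrbitPressure`),
`IsTypeIAncientMild.norm_le/contDiffOn/continuousOn_uncurry`, `IsClassicalNSSolutionOn.momentum`,
`exists_norm_iteratedFDeriv_le_of_typeI`, `exists_lipschitz_time_of_typeI`, Gaussian integrability
(`integrable_exp_neg_mul_sq_norm`-type lemmas, polynomial moments).] -/
theorem stub_gaussianChannelContinuous :
    ∀ (C : ℝ) (u : ℝ → EuclideanSpace ℝ (Fin 3) → EuclideanSpace ℝ (Fin 3))
      (p : ℝ → EuclideanSpace ℝ (Fin 3) → ℝ),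
      IsTypeIAncientMild C u → IsClassicalNSSolutionOn (Set.Iio 0) 1 0 u p →
      Continuous (fun s : ℝ =>
          ∫ y, (‖lerayOrbit u s y‖ ^ 2 / 2 + lerayOrbitPressure p s y) *
            ⟪y, lerayOrbit u s y⟫ * Real.exp (-‖y‖ ^ 2 / 4)) := by
  sorry

/-- **S2c — the GAUSSIAN ENERGY IDENTITY `E' = −D − E − ½Ch`** (the lever (GE); lead's reshape of
S2, 2026-08-16: the two continuity clauses are S2a/S2b). For a Type-I ancient mild field `u` with a
classical pressure `p` on `(−∞,0)`, in backward similarity variables `U = lerayOrbit u`,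
`P = lerayOrbitPressure p` (so `(U,P)` solves the backward Leray system
`∂ₛU + ½U + ½(y·∇)U + (U·∇)U + ∇P = ΔU`, tree
`isClassicalNSSolutionOn_Iio_iff_isBackwardLeraySolutionOn` + `IsBackwardLeraySolutionOn.momentum_leray`)
and with `G = e^{−‖y‖²/4}`, the Gaussian energy `E(s) = ∫ ½‖U‖² G` is differentiable at every `s`
with derivative `−D(s) − E(s) − ½Ch(s)` (`D = ∫ |∇U|²_F G`, `Ch = ∫ (½‖U‖² + P)⟪y,U⟫ G`).
Why true (re-derived by all three triagers and CAS job j007038): differentiate under the integral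
(`hasDerivAt_integral_of_dominated_loc_of_deriv_le`; `∂ₛ(½‖U‖²G) = ⟨U, ∂ₛU⟩G`, `∂ₛU` from
`hasDerivAt_lerayOrbit`, dominated by `(A + B‖y‖)G` locally uniformly in `s` via the class-uniform
window bounds on `u, ∇u, ∂ₜu`); then `E' = ∫⟨U, ∂ₛU⟩G` with `∂ₛU = ΔU − ½U − ½(y·∇)U − (U·∇)U − ∇P`
and three whole-space integrations by parts against the Gaussian
(`integral_bilinear_hasFDerivAt_right_eq_neg_left_of_integrable`, `∇G = −½yG`):
`∫⟨U, ΔU − ½(y·∇)U⟩G = −D` (Ornstein–Uhlenbeck self-adjointness), `∫⟨U,−½U⟩G = −E`,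
`∫⟨U,(U·∇)U + ∇P⟩G = ∫ U·∇(½‖U‖²+P) G = −∫(½‖U‖²+P) U·∇G = ½Ch` (`div U = 0`). All boundary
behaviour is Gaussian × polynomial (`‖U‖ ≤ C`, `∇U, ∇²U` bounded uniformly on compact `s`-ranges,
`P` of linear growth — see S2b). Size L.
[Leans on: `hasDerivAt_lerayOrbit`, `fderiv_lerayOrbit`, `laplacian_lerayOrbit`, `convect_lerayOrbit`,
`gradient_lerayOrbitPressure`, `lerayOrbit_momentum_iff` /
`isClassicalNSSolutionOn_Iio_iff_isBackwardLeraySolutionOn`, `frobeniusNormSq_eq_sum`,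
`IsTypeIAncientMild.isDivFree/contDiffOn/norm_le`, `exists_norm_iteratedFDeriv_le_of_typeI`,
`exists_lipschitz_time_of_typeI`, Mathlib `hasDerivAt_integral_of_dominated_loc_of_deriv_le`,
`integral_bilinear_hasFDerivAt_right_eq_neg_left_of_integrable`.] -/
theorem stub_gaussianEnergyDeriv :
    ∀ (C : ℝ) (u : ℝ → EuclideanSpace ℝ (Fin 3) → EuclideanSpace ℝ (Fin 3))
      (p : ℝ → EuclideanSpace ℝ (Fin 3) → ℝ),
      IsTypeIAncientMild C u → IsClassicalNSSolutionOn (Set.Iio 0) 1 0 u p →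
      ∀ s : ℝ,
        HasDerivAt (fun σ : ℝ => ∫ y, ‖lerayOrbit u σ y‖ ^ 2 / 2 * Real.exp (-‖y‖ ^ 2 / 4))
          (-(∫ y, frobeniusNormSq (fderiv ℝ (lerayOrbit u s) y) * Real.exp (-‖y‖ ^ 2 / 4))
            - (∫ y, ‖lerayOrbit u s y‖ ^ 2 / 2 * Real.exp (-‖y‖ ^ 2 / 4))
            - (∫ y, (‖lerayOrbit u s y‖ ^ 2 / 2 + lerayOrbitPressure p s y) *
                ⟪y, lerayOrbit u s y⟫ * Real.exp (-‖y‖ ^ 2 / 4)) / 2) s := by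
  sorry

/-- **S3 — the HEAD-FLUX CRITERION (FL2 of the card, averaged form): closing the channel on long
windows forces triviality.** Let `u` be a Type-I ancient mild field (constant `C`) and `p` any
scalar field; write `E, D, Ch` for the three Gaussian functionals of S2. If `D` and `Ch` are
continuous, `E' = −D − E − ½Ch` everywhere, and the head influx obeys the LAW
`∫ₐᵇ (−½Ch) ≤ (1 − ε) ∫ₐᵇ (D + E)` on every window `b − a ≥ S₀` for some `ε > 0`, then `u ≡ 0`.
Why true: `0 ≤ E ≤ ½C²(4π)^{3/2}` (`‖U‖ ≤ C`, `∫G = (4π)^{3/2}`), `D ≥ 0`; on windows of length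
`≥ S₀`, `E(b) − E(a) = ∫ₐᵇ E' ≤ −ε ∫ₐᵇ (D + E) ≤ 0`; along `aₙ → −∞`,
`∫_{aₙ}^b (D+E) ≤ (E(aₙ) − E(b))/ε ≤ M/ε`, so `D + E ∈ L¹(−∞,b)`, `E` is uniformly continuous
(`E'` bounded on `(−∞,b]` is not needed: use `E ≥ 0`, `∫E < ∞` and the window inequality again to
get `E(aₙ) → 0` along a sequence), whence `∫_{−∞}^b (D+E) ≤ −E(b)/ε ≤ 0`, i.e. `E ≡ 0` on
`(−∞, b]` for every `b`; then `‖U(s,·)‖²G = 0` a.e. (integrable, nonnegative, continuous) so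
`U ≡ 0` and `u(t,x) = (−t)^{−1/2}U(−log(−t), x/√(−t)) = 0` (`eq_lerayOrbit_of_neg`). Size M.
The free instance is the TOROIDAL LIOUVILLE theorem (FL1): `⟪x, u t x⟫ ≡ 0 ⇒ Ch ≡ 0 ⇒ u ≡ 0`.
[Leans on: `IsTypeIAncientMild.norm_le`, `lerayOrbit_apply`, `eq_lerayOrbit_of_neg`,
`contDiff_uncurry_lerayOrbit`, Mathlib `intervalIntegral.integral_eq_sub_of_hasDerivAt`,
`integral_exp_neg_mul_sq`-type Gaussian integrals, `integral_eq_zero_iff_of_nonneg`.] -/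
theorem stub_headFluxCriterion :
    ∀ (C : ℝ) (u : ℝ → EuclideanSpace ℝ (Fin 3) → EuclideanSpace ℝ (Fin 3))
      (p : ℝ → EuclideanSpace ℝ (Fin 3) → ℝ),
      IsTypeIAncientMild C u →
      Continuous (fun s : ℝ =>
          ∫ y, frobeniusNormSq (fderiv ℝ (lerayOrbit u s) y) * Real.exp (-‖y‖ ^ 2 / 4)) →
      Continuous (fun s : ℝ =>
          ∫ y, (‖lerayOrbit u s y‖ ^ 2 / 2 + lerayOrbitPressure p s y) *
            ⟪y, lerayOrbit u s y⟫ * Real.exp (-‖y‖ ^ 2 / 4)) →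
      (∀ s : ℝ,
        HasDerivAt (fun σ : ℝ => ∫ y, ‖lerayOrbit u σ y‖ ^ 2 / 2 * Real.exp (-‖y‖ ^ 2 / 4))
          (-(∫ y, frobeniusNormSq (fderiv ℝ (lerayOrbit u s) y) * Real.exp (-‖y‖ ^ 2 / 4))
            - (∫ y, ‖lerayOrbit u s y‖ ^ 2 / 2 * Real.exp (-‖y‖ ^ 2 / 4))
            - (∫ y, (‖lerayOrbit u s y‖ ^ 2 / 2 + lerayOrbitPressure p s y) *
                ⟪y, lerayOrbit u s y⟫ * Real.exp (-‖y‖ ^ 2 / 4)) / 2) s) →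
      (∃ ε : ℝ, 0 < ε ∧ ∃ S₀ : ℝ, ∀ a b : ℝ, a + S₀ ≤ b →
        (∫ s in a..b, -(∫ y, (‖lerayOrbit u s y‖ ^ 2 / 2 + lerayOrbitPressure p s y) *
            ⟪y, lerayOrbit u s y⟫ * Real.exp (-‖y‖ ^ 2 / 4)) / 2) ≤
          (1 - ε) * ∫ s in a..b,
            ((∫ y, frobeniusNormSq (fderiv ℝ (lerayOrbit u s) y) * Real.exp (-‖y‖ ^ 2 / 4)) +
              ∫ y, ‖lerayOrbit u s y‖ ^ 2 / 2 * Real.exp (-‖y‖ ^ 2 / 4))) →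
      ∀ t < 0, ∀ x, u t x = 0 := by
  sorry

/-- **S4 — the HEAD-INFLUX LAW (load-bearing; per rung constant `C`).** For every Type-I ancient
mild field `u` with constant `C` and classical pressure `p` on `(−∞,0)` there are `ε > 0` and a
window length `S₀` such that on every similarity-time window `[a,b]`, `b − a ≥ S₀`, the Gaussian
head INFLUX cannot supply more than the fraction `1 − ε` of the Gaussian budget:
`∫ₐᵇ (−½Ch) ≤ (1 − ε) ∫ₐᵇ (D + E)`  (notation of S2).
Status (honest): by S2–S3 and the necessity `avg(−½Ch) = avg(D+E)` for a nontrivial eternal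
profile, S4 at level `C` is EQUIVALENT to the Liouville theorem for `IsTypeIAncientMild C`
(rate class, Oseen gauge) — it is the crux of the line, not a lemma with an independent proof
today (triage r1-3: "costume on the all-C prong"; r1-1/r1-2: "doubt recorded, not a fail").
What it buys: (i) ONE scalar inequality, in which the only indefinite quantity is the correlation
of the head `½‖U‖²+P` with the sphere-mean-free bounded scalar `⟪y,U⟫` (`|⟪y,U⟫| ≤ C‖y‖`);
(ii) the SMALL-`C` SUB-CASE is a genuine estimate (kinetic part:
`|∫½‖U‖²⟪y,U⟫G| ≤ ½C ∫‖U‖²‖y‖G ≤ κ₁ C (D+E)` by the Gaussian Poincaré/Hardy inequality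
`∫‖y‖²f²G ≤ 24∫f²G + 16∫|∇f|²G`; pressure part via the local pressure split at the Gaussian
scale) giving `HeadInfluxLaw C` for `C < C₁` and hence, through S1–S3, the rungs `X_C`, `C < C₁`,
of the host ladder — informative only if `C₁ > √6 − √2 ≈ 1.035` (triage calibration: rungs below
are classical); (iii) for LARGE `C` any proof must use the EQUATION beyond the local energy
inequality: Scheffer's Navier–Stokes-INEQUALITY blow-up (in tree, PROVED:
`Literature.Barriers.NavierStokesRegularity.NavierStokesInequalitySingularSolution_holds`) is an
exactly DSS, Type-I-rate, finite-energy singularity for which S1–S3 survive (S2 as `E' ≤ …`), so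
its profile VIOLATES the law — the Oseen-mild clause of `IsTypeIAncientMild` (which excludes NSI
profiles) must be used essentially, e.g. through the equation-specific transport identity of the
radial Reynolds scalar `(∂ₜ + u·∇ − Δ)⟪x,u⟫ = ‖u‖² − ⟪x,∇p⟫` (FL3 of the card) or the head
equation `(∂ₛ − Δ + (U+½y)·∇)Π = −|Ω|² + ∂ₛP`. Why it might fail: only if Type-I Liouville fails
(a Type-I singularity exists); as a METHOD it fails if no equation-specific one-sided control of
`⟪x,u⟫` or `Π` on the class exists (the card's Landau test shows both signs of `Ch` among
critical steady NS fields with forcing at the origin). Size: open (rung sub-case M–L). -/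
theorem stub_headInfluxLaw :
    ∀ (C : ℝ) (u : ℝ → EuclideanSpace ℝ (Fin 3) → EuclideanSpace ℝ (Fin 3))
      (p : ℝ → EuclideanSpace ℝ (Fin 3) → ℝ),
      IsTypeIAncientMild C u → IsClassicalNSSolutionOn (Set.Iio 0) 1 0 u p →
      ∃ ε : ℝ, 0 < ε ∧ ∃ S₀ : ℝ, ∀ a b : ℝ, a + S₀ ≤ b →
        (∫ s in a..b, -(∫ y, (‖lerayOrbit u s y‖ ^ 2 / 2 + lerayOrbitPressure p s y) *
            ⟪y, lerayOrbit u s y⟫ * Real.exp (-‖y‖ ^ 2 / 4)) / 2) ≤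
          (1 - ε) * ∫ s in a..b,
            ((∫ y, frobeniusNormSq (fderiv ℝ (lerayOrbit u s) y) * Real.exp (-‖y‖ ^ 2 / 4)) +
              ∫ y, ‖lerayOrbit u s y‖ ^ 2 / 2 * Real.exp (-‖y‖ ^ 2 / 4)) := by
  sorry

/-! ## The composition -/

/-- **`NoTypeIBlowup` from S1–S4** (kernel-checked; concludes the crux BY NAME). By the route's
proved `LadderGlue_holds` it suffices to prove every rung `X_C`, `C > 0`: if a rung-`C` solution did
not extend, S1 gives a nontrivial Type-I ancient mild field `ū` with a classical pressure `q`; S2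
gives the Gaussian energy identity along its Leray orbit, S4 the head-influx law, and S3 forces
`ū ≡ 0` — contradiction. -/
theorem Target_of : NoTypeIBlowup := by
  refine LadderGlue_holds ?_
  intro C hC ν T hν hT u p hcl hLH hdec hrate
  by_contra hext
  obtain ⟨ū, hA, hnon⟩ := stub_typeIZoom C hC ν T hν hT u p hcl hLH hdec hrate hext
  obtain ⟨q, hclA⟩ := stub_ancientPressure C ū hA
  exact hnon (stub_headFluxCriterion C ū q hA (stub_gaussianDissipationContinuous C ū hA)
    (stub_gaussianChannelContinuous C ū q hA hclA) (stub_gaussianEnergyDeriv C ū q hA hclA)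
    (stub_headInfluxLaw C ū q hA hclA))

/-! ## A free instance: the toroidal Type-I Liouville theorem (FL1 of the card) -/

/-- **Toroidal Type-I Liouville from S2 + S3** (no S1, no S4): a Type-I ancient mild field whose
flow is tangent to every sphere about the origin (`⟪x, u(t,x)⟫ = 0`; the TOROIDAL half of the
Mie/Chandrasekhar–Kendall decomposition about the singular point, symmetry-free) is trivial — the
channel integrand vanishes identically (`⟪y, U(s,y)⟫ = e^{s/2}⟪x, u(t,x)⟫ = 0`), so the law holds
with `ε = ½`, `S₀ = 0`, and S3 applies. Checked here modulo the sorried S2, S3. -/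
theorem toroidalLiouville_of_S2_S3 (C : ℝ)
    (u : ℝ → EuclideanSpace ℝ (Fin 3) → EuclideanSpace ℝ (Fin 3))
    (p : ℝ → EuclideanSpace ℝ (Fin 3) → ℝ)
    (hA : IsTypeIAncientMild C u) (hcl : IsClassicalNSSolutionOn (Set.Iio 0) 1 0 u p)
    (htor : ∀ t < 0, ∀ x, ⟪x, u t x⟫ = 0) : ∀ t < 0, ∀ x, u t x = 0 := by
  refine stub_headFluxCriterion C u p hA (stub_gaussianDissipationContinuous C u hA)
    (stub_gaussianChannelContinuous C u p hA hcl) (stub_gaussianEnergyDeriv C u p hA hcl)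
    ⟨1 / 2, by norm_num, 0, fun a b hab => ?_⟩
  -- the channel vanishes at every similarity time
  have hzero : ∀ s : ℝ,
      (∫ y, (‖lerayOrbit u s y‖ ^ 2 / 2 + lerayOrbitPressure p s y) *
          ⟪y, lerayOrbit u s y⟫ * Real.exp (-‖y‖ ^ 2 / 4)) = 0 := by
    intro s
    refine integral_eq_zero_of_ae (Eventually.of_forall fun y => ?_)
    have ht : -Real.exp (-s) < 0 := neg_neg_of_pos (Real.exp_pos _)
    have key := htor _ ht (Real.exp (-s / 2) • y)
    have hinner : ⟪y, lerayOrbit u s y⟫ = 0 := by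
      rw [lerayOrbit_apply, real_inner_smul_right]
      rw [real_inner_smul_left] at key
      rcases mul_eq_zero.1 key with h | h
      · exact absurd h (Real.exp_pos _).ne'
      · rw [h, mul_zero]
    simp only [hinner, mul_zero, zero_mul, Pi.zero_apply]
  simp only [hzero, neg_zero, zero_div, intervalIntegral.integral_zero]
  have hab' : a ≤ b := by linarith
  refine mul_nonneg (by norm_num) (intervalIntegral.integral_nonneg hab' fun s _ => ?_)
  exact add_nonneg
    (integral_nonneg fun y => mul_nonneg (frobeniusNormSq_nonneg _) (Real.exp_pos _).le)
    (integral_nonneg fun y => mul_nonneg (by positivity) (Real.exp_pos _).le)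

end Summit.NavierStokesRegularity.NavierStokesRegularity.Cruxes.Target.HeadFluxChannel

end
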